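import Summits.CriticalPhenomena.CardyFormulaZ2.Theorems.CardyUSTContinuationKirchhoffExtremalLengthG02Dual8
import Summits.CriticalPhenomena.CardyFormulaZ2.Theorems.CardyUSTContinuationKirchhoffExtremalLengthG02Dual6

/-!
# Weak Beurling for the conjugate at the exits near a boundary point
# ([GP19] Lemma 4.8, dual discrete form, for the `meshDomain` / `discreteArc` discretisation)

Support file for `KirchhoffExtremalLength` (route CardyUSTContinuation of `CardyFormulaZ2`, item
stmt-CriticalPhenomena-11234), towards the upper half of `G02ModulusConvergence` (`…Defs.lean`).
Transposition of §D7 of the tree's `SquareTilingConjugate.lean` to `Ω_δ = discreteDomainGraph Ω δ`: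

* `abs_facePot_sub_le_beurling`: with the exits in a box around a boundary square having the
  common value `c` and a cutting walk outside the component, `|facePot - c|` is small well
  inside the box (weak Beurling `weakBeurling_of_cutPath` on the face component);
* `abs_facePot_sub_faceExitVal_le`: the geometric form near a boundary point `q` far from
  `T ∪ B`. The equality of the exit values in the box is obtained from the flux-free EXTERIOR
  connections of `…G02Dual6.lean` (uniform local connectedness of the exterior, a hypothesis),
  instead of the short boundary arcs of the tree's `SquareTiling.abs_dualPot_sub_exitVal_le`.
-/

noncomputable section

namespace Summit.CriticalPhenomena.CardyFormulaZ2.Theorems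

namespace KirchhoffSlope

open Set Metric Filter Topology SimpleGraph
open Literature.Probability Literature.Probability.LatticeModels Literature.Probability.Percolation
open Literature.Probability.LatticeModels.SquareTiling (stepFlux walkFlux closedSq floorSq
  mem_closedSq_floorSq abs_floorSq_sub_le exists_dualWalk_of_path dist_le_of_mem_sqBox)
open Literature.Probability.RandomPlanarGeometry

variable {δ : ℝ}

open WeakBeurling

open Classical in
/-- **Weak Beurling for the conjugate** (the dual counterpart of `exists_forall_one_sub_le` of
`SquareTilingModulusProofs.lean`, replacing the Brownian motion of [GP19], Lemma 4.8 on the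
dual graph). With the hypotheses of `abs_facePot_sub_le_local` on the box `sqBox qc (2(R+3))`
about a square `qc` next to the square `p` from which the cutting walk starts: on the component,
`|h' - c| ≤ (1 + 8√E) · C_B · ((ρ+1)/(R+1))^β` at the squares of `sqBox p ρ ∩ sqBox p R`. Proof:
the site function `(h' - c)/(1 + 8√E)` on the component (and `0` elsewhere) is lattice harmonic
on `S = component ∩ sqBox p R` (CR around each inner square, exits having value `c`), bounded
by `1` on `∂S` (local bound) and `0` on `∂S ∩ sqBox p R` (exits), and the cutting walk avoids
`S`; apply `weakBeurling_of_cutPath` to it and to its negative. [cite: GeorgakopoulosPanagiotis2019, Lemma 4.8 (dual, discrete form)] -/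
theorem abs_facePot_sub_le_beurling (R : ConformalRectangle) (hδ : 0 < δ) {h : Site 2 → ℝ} {T B : Set (Site 2)}
    (hT : T ⊆ meshBoundary R.carrier δ) (hB : B ⊆ meshBoundary R.carrier δ)
    (hharm : ∀ x, x ∉ T → x ∉ B →
      ∑ y ∈ ((zdGraph 2).neighborFinset x).filter (fun y => (discreteDomainGraph R.carrier δ).Adj x y), (h y - h x) = 0)
    (h01 : ∀ x, h x ∈ Icc (0 : ℝ) 1) {p₀ : Site 2} (hp₀ : IsInnerFace R.carrier δ p₀) {E : ℝ}
    (hE : ∑ e ∈ (edgeSet_discreteDomainGraph_finite R.isBounded hδ).toFinset, sqIncr h e ≤ E)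
    {c : ℝ} {qc p : Site 2} {Rb : ℕ} (hRb : 1 ≤ Rb) (hpqc : p ∈ sqBox qc 1)
    (hexit : ∀ p', (faceGraph R.carrier δ).Reachable p₀ p' → p' ∈ sqBox qc (2 * (Rb + 3)) → ∀ n, (zdGraph 2).Adj p' n →
      ¬ (faceGraph R.carrier δ).Reachable p₀ n → faceExitVal R.carrier δ h p₀ p' n = c)
    {d : Site 2} (Wcut : (zdGraph 2).Walk p d) (hd : d ∉ sqBox qc (2 * (Rb + 3)))
    (hWcut : ∀ z ∈ Wcut.support, ¬ (faceGraph R.carrier δ).Reachable p₀ z)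
    {ρ : ℕ} {z : Site 2} (hz : (faceGraph R.carrier δ).Reachable p₀ z) (hzρ : z ∈ sqBox p ρ) (hzR : z ∈ sqBox p Rb) :
    |facePot R.carrier δ h p₀ z - c| ≤
      (1 + 8 * Real.sqrt E) * beurlingConst * (((ρ : ℝ) + 1) / ((Rb : ℝ) + 1)) ^ beurlingExp := by
  set M : ℝ := 1 + 8 * Real.sqrt E with hM
  have hM0 : 0 < M := by rw [hM]; positivity
  set Fc : Set (Site 2) := {q | (faceGraph R.carrier δ).Reachable p₀ q} with hFc
  set g : Site 2 → ℝ := fun q => if (faceGraph R.carrier δ).Reachable p₀ q then (facePot R.carrier δ h p₀ q - c) / M else 0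
    with hg
  set S : Set (Site 2) := {q | (faceGraph R.carrier δ).Reachable p₀ q ∧ q ∈ sqBox p Rb} with hS
  -- boxes
  have hpqc' := hpqc
  rw [mem_sqBox, abs_le, abs_le] at hpqc'
  have hbox1 : ∀ w : Site 2, w ∈ sqBox p (Rb + 1) → w ∈ sqBox qc (Rb + 3) := by
    intro w hw
    rw [mem_sqBox, abs_le, abs_le] at hw ⊢; omega
  have hbox2 : ∀ w : Site 2, w ∈ sqBox qc (Rb + 3) → w ∈ sqBox qc (2 * (Rb + 3)) := fun w hw =>
    sqBox_mono qc (by omega) hw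
  -- the local bound on `sqBox qc (Rb + 3)`
  have hloc : ∀ w, (faceGraph R.carrier δ).Reachable p₀ w → w ∈ sqBox qc (Rb + 3) →
      |facePot R.carrier δ h p₀ w - c| ≤ M := by
    intro w hw hwb
    have hJ : 1 ≤ Rb + 3 := by omega
    refine abs_facePot_sub_le_local R hδ hT hB hharm h01 hp₀ hE (qc := qc) (J := Rb + 3) hJ
      (fun p' hp' hb n hn hn' => hexit p' hp' (by simpa using hb) n hn hn') Wcut
      (sqBox_mono qc (by omega) hpqc) (by simpa using hd) hWcut hw (by simpa using hwb)
  -- `S` is finite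
  have hSfin : S.Finite := (sqBox_finite p Rb).subset fun q hq => hq.2
  -- `g` is lattice harmonic on `S`
  have hgharm : IsLatticeHarmonicOn g S := by
    intro q hq
    obtain ⟨hqF, hqb⟩ := hq
    have hqI : IsInnerFace R.carrier δ q := by
      obtain ⟨W⟩ := hqF; exact isInnerFace_of_mem_support' hp₀ W (Walk.end_mem_support _)
    rw [latticeLaplacian]
    have hterm : ∀ k : Fin 4, g (q + cornerUnit k) - g q =
        stepFlux (ecurH R.carrier δ h) (ecurV R.carrier δ h) q (q + cornerUnit k) / M := by
      intro k
      simp only [hg, if_pos hqF]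
      split_ifs with hr
      · have hadj : (faceGraph R.carrier δ).Adj q (q + cornerUnit k) := by
          refine faceGraph_adj_iff.2 ⟨adj_of_stepKind (stepKind_add_cornerUnit q k), hqI, ?_⟩
          obtain ⟨W⟩ := hr; exact isInnerFace_of_mem_support' hp₀ W (Walk.end_mem_support _)
        rw [← facePot_sub_facePot_of_adj R hδ hT hB hharm hp₀ hqF hadj]
        ring
      · have hqbox : q ∈ sqBox qc (2 * (Rb + 3)) :=
          hbox2 q (hbox1 q (sqBox_mono p (by omega) hqb))
        have := hexit q hqF hqbox _ (adj_of_stepKind (stepKind_add_cornerUnit q k)) hr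
        rw [faceExitVal] at this
        field_simp
        linarith
    rw [Finset.sum_congr rfl fun k _ => hterm k, ← Finset.sum_div, Fin.sum_univ_four]
    have := sum_stepFlux_eq_zero_of_isInnerFace (h := h) hqI
    simp only [cornerUnit] at this ⊢
    rw [show q + -Pi.single (0 : Fin 2) (1 : ℤ) = q - Pi.single 0 1 by abel,
      show q + -Pi.single (1 : Fin 2) (1 : ℤ) = q - Pi.single 1 1 by abel,
      show stepFlux (ecurH R.carrier δ h) (ecurV R.carrier δ h) q (q + Pi.single 0 1) +
        stepFlux (ecurH R.carrier δ h) (ecurV R.carrier δ h) q (q + Pi.single 1 1) +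
        stepFlux (ecurH R.carrier δ h) (ecurV R.carrier δ h) q (q - Pi.single 0 1) +
        stepFlux (ecurH R.carrier δ h) (ecurV R.carrier δ h) q (q - Pi.single 1 1) = 0 by linarith, zero_div]
  -- bounds on the outer boundary
  have h1 : ∀ w ∈ latticeOuterBoundary S, |g w| ≤ 1 := by
    intro w hw
    obtain ⟨hwS, v, hvS, hadj⟩ := mem_latticeOuterBoundary_iff.1 hw
    simp only [hg]
    split_ifs with hr
    · -- a member of the component just outside the box `sqBox p Rb`: within `sqBox p (Rb+1)`
      have hvb : w ∈ sqBox p (Rb + 1) := mem_sqBox_succ_of_adj hvS.2 hadj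
      have := hloc _ hr (hbox1 _ hvb)
      rw [abs_div, abs_of_pos hM0, div_le_one hM0]
      exact this
    · simp
  have h0' : ∀ w ∈ latticeOuterBoundary S, w ∈ sqBox p Rb → g w = 0 := by
    intro w hw hwb
    obtain ⟨hwS, v, hvS, hadj⟩ := mem_latticeOuterBoundary_iff.1 hw
    simp only [hg]
    rw [if_neg]
    intro hr
    exact hwS ⟨hr, hwb⟩
  -- the cut
  have hcut : ∀ w ∈ Wcut.support, w ∉ S := fun w hw hwS => hWcut w hw hwS.1
  have hdR : d ∉ sqBox p Rb := fun hdb => hd (hbox2 d (hbox1 d (sqBox_mono p (by omega) hdb)))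
  have hzS : z ∈ S := ⟨hz, hzR⟩
  -- Beurling for `g` and `-g`
  have hB1 := weakBeurling_of_cutPath hSfin hgharm (fun w hw => (le_abs_self _).trans (h1 w hw)) h0' Wcut hdR hcut hzS hzρ
  have hgneg : IsLatticeHarmonicOn (fun q => -g q) S := fun q hq => by
    have := hgharm q hq
    rw [latticeLaplacian] at this ⊢
    rw [← neg_eq_zero, ← this, ← Finset.sum_neg_distrib]
    exact Finset.sum_congr rfl fun k _ => by ring
  have hB2 := weakBeurling_of_cutPath hSfin hgneg (fun w hw => (neg_le_abs _).trans (h1 w hw))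
    (fun w hw hwb => by simp [h0' w hw hwb]) Wcut hdR hcut hzS hzρ
  have hgz : g z = (facePot R.carrier δ h p₀ z - c) / M := by simp only [hg, if_pos hz]
  rw [hgz] at hB1 hB2
  have habs : |(facePot R.carrier δ h p₀ z - c) / M| ≤ beurlingConst * (((ρ : ℝ) + 1) / ((Rb : ℝ) + 1)) ^ beurlingExp := by
    rw [abs_le]; constructor <;> linarith
  rw [abs_div, abs_of_pos hM0, div_le_iff₀ hM0] at habs
  linarith



open Classical in
/-- **The conjugate near a boundary point far from `T ∪ B` is nearly constant at the exits**
(geometric form of `abs_facePot_sub_le_beurling`). Let `q = boundary s₀`, `ε > 0` with all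
vertices of `T ∪ B` at distance `≥ ε + 3δ` from `q`, `ρ ≤ ε` a radius for
`JordanDomain.exists_joinedIn_exterior_diff_closedBall`, and `r_arc` a radius with
`r_arc + 3δ ≤ ρ - 4δ` such that exterior points within `r_arc + 3δ` of `q` are joined by exterior
paths inside `B(q, ρ - 4δ)` (uniform local connectedness of the exterior; this replaces the short
boundary arcs of the tree's `SquareTiling.abs_dualPot_sub_exitVal_le`); let `e` be an exterior point within `δ/2` of
`q`, `p` its square, `qc` the square of `q`, and `Rb ≥ 1` with `2(2 Rb + 10) δ < r_arc`. Then for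
every exit `(p₁, n₁)` of the component of `p₀` in `sqBox qc (2(Rb+3))` and every square `z` of
the component in `sqBox p ρ' ∩ sqBox p Rb`,
`|h'(z) - E(p₁, n₁)| ≤ (1 + 8 √E) · C_B · ((ρ'+1)/(Rb+1))^β`. [cite: GeorgakopoulosPanagiotis2019, Lemma 4.8 (dual, discrete form)] -/
theorem abs_facePot_sub_faceExitVal_le (R : ConformalRectangle) (hδ : 0 < δ) {h : Site 2 → ℝ} {T B : Set (Site 2)}
    (hT : T ⊆ meshBoundary R.carrier δ) (hB : B ⊆ meshBoundary R.carrier δ)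
    (hharm : ∀ x, x ∉ T → x ∉ B →
      ∑ y ∈ ((zdGraph 2).neighborFinset x).filter (fun y => (discreteDomainGraph R.carrier δ).Adj x y), (h y - h x) = 0)
    (h01 : ∀ x, h x ∈ Icc (0 : ℝ) 1) {p₀ : Site 2} (hp₀ : IsInnerFace R.carrier δ p₀) {E : ℝ}
    (hE : ∑ e ∈ (edgeSet_discreteDomainGraph_finite R.isBounded hδ).toFinset, sqIncr h e ≤ E)
    {s₀ ε ρ rarc : ℝ} (hε : 0 < ε) (hρε : ρ ≤ ε)
    (hρ : ∀ e y : ℂ, e ∈ (closure R.carrier)ᶜ → y ∈ (closure R.carrier)ᶜ →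
      ε ≤ dist e (R.boundary s₀) → ε ≤ dist y (R.boundary s₀) →
      JoinedIn ((closure R.carrier)ᶜ \ closedBall (R.boundary s₀) ρ) e y)
    (hulc : ∀ e₁ e₂ : ℂ, e₁ ∈ (closure R.carrier)ᶜ → e₂ ∈ (closure R.carrier)ᶜ →
      dist e₁ (R.boundary s₀) < rarc + 3 * δ → dist e₂ (R.boundary s₀) < rarc + 3 * δ →
      JoinedIn ((closure R.carrier)ᶜ ∩ ball (R.boundary s₀) (ρ - 4 * δ)) e₁ e₂)
    (hrarc : rarc + 3 * δ ≤ ρ - 4 * δ)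
    (hfar : ∀ x ∈ T ∪ B, ε + 3 * δ ≤ dist (meshPoint δ x) (R.boundary s₀))
    {Rb : ℕ} (hRb : 1 ≤ Rb) (hbox : 2 * (2 * Rb + 10) * δ < rarc)
    {e : ℂ} (he : e ∈ (closure R.carrier)ᶜ) (heq : dist e (R.boundary s₀) < δ / 2)
    {p₁ n₁ : Site 2} (hp₁ : (faceGraph R.carrier δ).Reachable p₀ p₁) (hp₁b : p₁ ∈ sqBox (floorSq δ (R.boundary s₀)) (2 * (Rb + 3)))
    (hn₁ : (zdGraph 2).Adj p₁ n₁) (hn₁' : ¬ (faceGraph R.carrier δ).Reachable p₀ n₁)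
    {ρ' : ℕ} {z : Site 2} (hz : (faceGraph R.carrier δ).Reachable p₀ z) (hzρ : z ∈ sqBox (floorSq δ e) ρ')
    (hzR : z ∈ sqBox (floorSq δ e) Rb) :
    |facePot R.carrier δ h p₀ z - faceExitVal R.carrier δ h p₀ p₁ n₁| ≤
      (1 + 8 * Real.sqrt E) * beurlingConst * (((ρ' : ℝ) + 1) / ((Rb : ℝ) + 1)) ^ beurlingExp := by
  set q := R.boundary s₀ with hq
  set qc := floorSq δ q with hqc
  set p := floorSq δ e with hp
  have hqqc : q ∈ closedSq δ qc := mem_closedSq_floorSq hδ q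
  -- `p ∈ sqBox qc 1`
  have hpqc : p ∈ sqBox qc 1 := by
    rw [mem_sqBox]
    exact ⟨abs_floorSq_sub_le hδ (by linarith [heq] : dist e q < δ) 0,
      abs_floorSq_sub_le hδ (by linarith [heq] : dist e q < δ) 1⟩
  -- exits: the inner and the outer square
  have hIof : ∀ {p' : Site 2}, (faceGraph R.carrier δ).Reachable p₀ p' → IsInnerFace R.carrier δ p' := fun hp' => by
    obtain ⟨W⟩ := hp'; exact isInnerFace_of_mem_support' hp₀ W (Walk.end_mem_support _)
  have hnIof : ∀ {p' n : Site 2}, (faceGraph R.carrier δ).Reachable p₀ p' → (zdGraph 2).Adj p' n →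
      ¬ (faceGraph R.carrier δ).Reachable p₀ n → ¬ IsInnerFace R.carrier δ n := fun hp' hadj hnr hnI =>
    hnr (hp'.trans (faceGraph_adj_iff.2 ⟨hadj, hIof hp', hnI⟩).reachable)
  -- outer squares of exits in the big box contain boundary points within `rarc` of `q`
  have hJpt : ∀ p' n : Site 2, (faceGraph R.carrier δ).Reachable p₀ p' → p' ∈ sqBox qc (2 * (Rb + 3)) →
      (zdGraph 2).Adj p' n → ¬ (faceGraph R.carrier δ).Reachable p₀ n →
      ∃ j ∈ closedSq δ n, dist j q < rarc := by
    intro p' n hp' hb hadj hnr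
    obtain ⟨j, hj, -⟩ := exists_mem_frontier_of_adj_not_isInnerFace R hδ (hIof hp') hadj (hnIof hp' hadj hnr)
    refine ⟨j, hj, ?_⟩
    have hnb : n ∈ sqBox qc (2 * (Rb + 3) + 1) := mem_sqBox_succ_of_adj hb hadj
    have := dist_le_of_mem_sqBox hδ.le hnb hj hqqc
    push_cast at this
    nlinarith
  -- all exits in the big box have the value `c = E(p₁, n₁)` (flux-free exterior connections)
  have hexit : ∀ p', (faceGraph R.carrier δ).Reachable p₀ p' → p' ∈ sqBox qc (2 * (Rb + 3)) → ∀ n, (zdGraph 2).Adj p' n →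
      ¬ (faceGraph R.carrier δ).Reachable p₀ n → faceExitVal R.carrier δ h p₀ p' n = faceExitVal R.carrier δ h p₀ p₁ n₁ := by
    intro p' hp' hb n hadj hnr
    obtain ⟨ω, hω0, hωs⟩ := exists_fluxFree_walk R hδ h (S := ball q (ρ - 4 * δ)) hulc (hIof hp') hadj
      (hnIof hp' hadj hnr) (hIof hp₁) hn₁ (hnIof hp₁ hn₁ hn₁') (hJpt p' n hp' hb hadj hnr) (hJpt p₁ n₁ hp₁ hp₁b hn₁ hn₁')
    exact faceExitVal_eq_faceExitVal R hδ hT hB hharm hp₀ hε hρε hρ hfar hp' hadj hp₁ hn₁ ω hω0 fun Q hQ => by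
      obtain ⟨w, hw, hwq⟩ := hωs Q hQ
      refine ⟨w, hw, ?_⟩
      rcases hwq with h' | h' | h'
      · exact mem_ball.1 h'
      · exact h'.trans_le hrarc
      · exact h'.trans_le hrarc
  -- the cutting walk: an exterior path from `e` to a far point, shadowed by squares outside the component
  obtain ⟨r₀, hr₀⟩ := (isBounded_iff_subset_closedBall (0 : ℂ)).1 R.isBounded
  have hqr : ‖q‖ ≤ r₀ := by
    have : q ∈ closedBall (0 : ℂ) r₀ :=
      closure_minimal hr₀ isClosed_closedBall (frontier_subset_closure (R.boundary_mem_frontier s₀))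
    simpa using this
  have hr₀nn : 0 ≤ r₀ := (norm_nonneg _).trans hqr
  set X : ℝ := 2 * r₀ + 2 + δ * (6 * Rb + 20) with hX
  have hX0 : 0 < X := by rw [hX]; positivity
  have hfarX : (X : ℂ) ∈ (closure R.carrier)ᶜ := by
    intro hmem
    have : (X : ℂ) ∈ closedBall (0 : ℂ) r₀ := closure_minimal hr₀ isClosed_closedBall hmem
    have h1 : ‖(X : ℂ)‖ ≤ r₀ := by simpa using this
    rw [Complex.norm_real, Real.norm_eq_abs, abs_of_pos hX0] at h1
    rw [hX] at h1; nlinarith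
  have hpath : JoinedIn (closure R.carrier)ᶜ e (X : ℂ) :=
    ((R.isOpen_exterior.isConnected_iff_isPathConnected).1 R.isConnected_exterior).joinedIn e he _ hfarX
  have hγc : ContinuousOn (fun t : ℝ => hpath.somePath.extend t) (Icc 0 1) :=
    hpath.somePath.continuous_extend.continuousOn
  have hγE : ∀ t ∈ Icc (0 : ℝ) 1, hpath.somePath.extend t ∈ (closure R.carrier)ᶜ := fun t ht => by
    rw [Path.extend_extends' hpath.somePath ⟨t, ht⟩]
    exact hpath.somePath_mem _
  obtain ⟨Wcut, -, hWs⟩ := exists_dualWalk_of_path hδ zero_le_one hγc (P := p) (P' := floorSq δ (X : ℂ))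
    (by simpa [hp] using mem_closedSq_floorSq hδ e) (by simpa using mem_closedSq_floorSq hδ (X : ℂ))
  have hWcut : ∀ w ∈ Wcut.support, ¬ (faceGraph R.carrier δ).Reachable p₀ w := by
    intro w hw hwr
    obtain ⟨t, ht, hγt⟩ := hWs w hw
    have hwI : IsInnerFace R.carrier δ w := by
      obtain ⟨W⟩ := hwr; exact isInnerFace_of_mem_support' hp₀ W (Walk.end_mem_support _)
    exact not_isInnerFace_of_mem_closedSq R hδ hγt (hγE t ht) hwI
  have hd : floorSq δ (X : ℂ) ∉ sqBox qc (2 * (Rb + 3)) := by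
    intro hdb
    have := dist_le_of_mem_sqBox hδ.le hdb (mem_closedSq_floorSq hδ (X : ℂ)) hqqc
    have h1 : ‖(X : ℂ)‖ - ‖q‖ ≤ dist (X : ℂ) q := by
      rw [dist_eq_norm]; exact norm_sub_norm_le _ _
    rw [Complex.norm_real, Real.norm_eq_abs, abs_of_pos hX0] at h1
    push_cast at this
    have h2 : X - ‖q‖ ≤ 2 * (2 * (Rb + 3) + 1) * δ := h1.trans this
    rw [hX] at h2
    nlinarith
  exact abs_facePot_sub_le_beurling R hδ hT hB hharm h01 hp₀ hE hRb hpqc hexit Wcut hd hWcut hz hzρ hzR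


end KirchhoffSlope

end Summit.CriticalPhenomena.CardyFormulaZ2.Theorems
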